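import Literature.Probability.RandomPlanarGeometry.SLEMarkovKernelInitial
import Literature.Probability.RandomPlanarGeometry.LoewnerTipPreimage
import Literature.Probability.RandomPlanarGeometry.LoewnerDescriptionProofs
import HarnessLib

/-!
# The domain-Markov kernel of chordal SLE_κ at first-visit configurations

Topic `Probability/RandomPlanarGeometry`; theorems and one definition (companion of
`SLEMarkovKernel.lean` / `SLEMarkovKernelInitial.lean`, crux `stmt-CriticalPhenomena-0698`, stub
`stub_isDomainMarkov`).

* first-visit configurations — the tip `γ r` has not been visited before time `r`,
  `c.γ c.r ∉ c.γ '' Iio c.r` (the case of every first hitting time of a closed set);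
* `SLEConfig.eq_zero_of_hasBoundaryValue_conf_tip` — at a first-visit configuration the tip is
  the boundary value of the parametrisation at `0` ONLY (injectivity of the boundary
  correspondence + the unique real preimage of a first-visit tip under `f̄_r`,
  `Loewner.IsGeneratedByCurve.eq_driving_of_bdryInv_eq_of_notMem`);
* `sleImageLaw_eq_of_realises` — two configurations realising the same triple, one of them
  first-visit, have the same image law (rigidity + scale invariance);
* **`sleMarkovKernel_eq_of_isFirstVisit`** — hence the kernel at a triple realised by a
  first-visit configuration IS the image law of that configuration: the well-definedness of
  Werner's `P_{D_t, γ_t, b}` in the set/point form of the tree's `IsMarkovExtension.domain`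
  (the "prime-end caveat" of `ChordalCurveFamily` resolved at first-visit tips).

References: W. Werner (2007), §3.2 (2); G. F. Lawler (2005), §6.1–6.3; Ch. Pommerenke (1992),
§2.4 (prime ends), Thm. 2.6.
-/

noncomputable section

open Set Filter Topology MeasureTheory ProbabilityTheory Complex
open UpperHalfPlane (upperHalfPlaneSet isOpen_upperHalfPlaneSet)
open scoped NNReal ENNReal unitInterval

namespace Literature.Probability.RandomPlanarGeometry


/-! ### The kernel at a first-visit configuration is the image law of that configuration -/

section FirstVisit

variable {κ : ℝ≥0}

namespace SLEConfig

variable (c : SLEConfig)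

/-- `Φ` is injective on the closed half-plane (boundary correspondence). [cite: PommerenkeBBCM1992, Thm. 2.6] -/
theorem injOn_Φ : InjOn c.Φ {z : ℂ | 0 ≤ z.im} :=
  JordanDomain.injOn_boundaryExtension c.φ

/-- **At a first-visit configuration, the tip is the boundary value of `conf` at `0` only**
(injectivity of `Φ` on the closed half-plane + the unique real preimage of a first-visit tip
under `f̄_r`, `Loewner.IsGeneratedByCurve.eq_driving_of_bdryInv_eq_of_notMem`). [folklore] -/
theorem eq_zero_of_hasBoundaryValue_conf_tip (hfv : c.γ c.r ∉ c.γ '' Iio c.r) {x : ℝ}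
    (hx : c.conf.HasBoundaryValue x c.tip) : x = 0 := by
  rw [c.hasBoundaryValue_conf_iff (by simp), c.ψ_apply_of_im_nonneg (by simp)] at hx
  change c.Φ _ = c.Φ (c.γ c.r) at hx
  have h1 : Loewner.bdryInv c.W c.r ((x : ℂ) + c.W c.r) = c.γ c.r := by
    refine c.injOn_Φ (c.bdryInv_im_nonneg (by simp)) ?_ hx
    exact c.isGeneratedByCurve.im_nonneg _
  have h2 : Loewner.bdryInv c.W c.r ((x + c.W c.r : ℝ) : ℂ) = c.γ c.r := by
    push_cast
    exact h1
  have h3 := c.isGeneratedByCurve.eq_driving_of_bdryInv_eq_of_notMem c.contW hfv h2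
  linarith

end SLEConfig

/-- **Two configurations realising the same triple, one of them first-visit, have the same image
law**: their parametrisations differ by a dilation (rigidity
`ConformalEquiv.exists_eqOn_comp_mul_of_boundaryValues`), and the image law is dilation
invariant (`sleImageLaw_comp_mul`). [cite: Lawler2005, §6.1] -/
theorem sleImageLaw_eq_of_realises (h0 : HasSLETrace κ)
    (htr : ∀ᵐ ω ∂Process.preWienerMeasure, Tendsto (fun t ↦ ‖sleTrace κ ω t‖) atTop atTop) {c₀ c₁ : SLEConfig} (hfv : c₀.γ c₀.r ∉ c₀.γ '' Iio c₀.r)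
    {U : Set ℂ} {z b : ℂ} (h₀ : c₀.Realises U z b) (h₁ : c₁.Realises U z b) :
    sleImageLaw κ c₁.ψ b = sleImageLaw κ c₀.ψ b := by
  obtain ⟨hU₀, hz₀, hb₀⟩ := h₀
  obtain ⟨hU₁, hz₁, hb₁⟩ := h₁
  -- both parametrisations as conformal equivalences onto `U`
  set ψ₁ : ConformalEquiv upperHalfPlaneSet U := hU₀ ▸ c₀.conf with hψ₁
  set ψ₂ : ConformalEquiv upperHalfPlaneSet U := hU₁ ▸ c₁.conf with hψ₂
  have hbv : ∀ x : ℝ, ∃ p, ψ₁.HasBoundaryValue x p := fun x ↦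
    ⟨c₀.ψ x, by rw [hψ₁, ConformalEquiv.hasBoundaryValue_cast_iff]; exact c₀.hasBoundaryValue_conf x⟩
  have h0₁ : ψ₁.HasBoundaryValue 0 z := by
    rw [hψ₁, ConformalEquiv.hasBoundaryValue_cast_iff, ← hz₀]; exact c₀.hasBoundaryValue_conf_zero
  have h0₂ : ψ₂.HasBoundaryValue 0 z := by
    rw [hψ₂, ConformalEquiv.hasBoundaryValue_cast_iff, ← hz₁]; exact c₁.hasBoundaryValue_conf_zero
  have hinf₁ : ψ₁.HasBoundaryValueAtInfty b := by
    rw [hψ₁, ConformalEquiv.hasBoundaryValueAtInfty_cast_iff, ← hb₀]; exact c₀.hasBoundaryValueAtInfty_conf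
  have hinf₂ : ψ₂.HasBoundaryValueAtInfty b := by
    rw [hψ₂, ConformalEquiv.hasBoundaryValueAtInfty_cast_iff, ← hb₁]; exact c₁.hasBoundaryValueAtInfty_conf
  have huniq : ∀ x : ℝ, ψ₁.HasBoundaryValue x z → x = 0 := fun x hx ↦ by
    rw [hψ₁, ConformalEquiv.hasBoundaryValue_cast_iff, ← hz₀] at hx
    exact c₀.eq_zero_of_hasBoundaryValue_conf_tip hfv hx
  have hzb : z ≠ b := by rw [← hz₀, ← hb₀]; exact c₀.tip_ne_tgt
  have hb : ∀ x : ℝ, ¬ ψ₁.HasBoundaryValue x b := fun x hx ↦ by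
    rw [hψ₁, ConformalEquiv.hasBoundaryValue_cast_iff, ← hb₀] at hx
    exact c₀.not_hasBoundaryValue_conf_tgt x hx
  obtain ⟨cst, hcst, hEq⟩ :=
    ConformalEquiv.exists_eqOn_comp_mul_of_boundaryValues ψ₁ ψ₂ hbv h0₁ h0₂ hinf₁ hinf₂ huniq hzb hb
  -- `c₁.ψ = c₀.ψ ∘ (cst • ·)` on the closed half-plane
  have hS : EqOn c₁.ψ (fun w ↦ c₀.ψ ((cst : ℂ) * w)) upperHalfPlaneSet := fun w hw ↦ by
    have h : ψ₂ w = ψ₁ ((cst : ℂ) * w) := hEq hw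
    rw [hψ₂, hψ₁, ConformalEquiv.cast_apply, ConformalEquiv.cast_apply] at h
    exact h
  have hcl : EqOn c₁.ψ (fun w ↦ c₀.ψ ((cst : ℂ) * w)) (closure upperHalfPlaneSet) :=
    hS.of_subset_closure c₁.continuous_ψ.continuousOn
      (c₀.continuous_ψ.comp (by fun_prop)).continuousOn subset_closure subset_rfl
  have hclosed : ∀ w : ℂ, 0 ≤ w.im → c₁.ψ w = c₀.ψ ((cst : ℂ) * w) := fun w hw ↦
    hcl (mem_closure_upperHalfPlaneSet_iff.2 hw)
  rw [sleImageLaw_congr hclosed, ← hb₀]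
  rw [hb₀]
  have htend : Tendsto c₀.ψ (cocompact ℂ ⊓ 𝓟 {z : ℂ | 0 ≤ z.im}) (𝓝 b) := by
    rw [← hb₀, ← ConformalEquiv.closure_upperHalfPlaneSet_eq]
    exact c₀.tendsto_ψ_cocompact
  exact sleImageLaw_comp_mul h0 htr c₀.measurable_ψ c₀.continuous_ψ.continuousOn htend hcst

/-- **The kernel at a triple realised by a first-visit configuration is the image law of that
configuration.** [cite: Werner2007, §3.2] -/
theorem sleMarkovKernel_eq_of_isFirstVisit (h0 : HasSLETrace κ)
    (htr : ∀ᵐ ω ∂Process.preWienerMeasure, Tendsto (fun t ↦ ‖sleTrace κ ω t‖) atTop atTop) {D : DobrushinDomain} {past : CurveClass ℂ}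
    {c₀ : SLEConfig} (hfv : c₀.γ c₀.r ∉ c₀.γ '' Iio c₀.r)
    (h₀ : c₀.Realises (remainingDomain D past) past.target (D.pt 1)) :
    sleMarkovKernel κ D past = sleImageLaw κ c₀.ψ (D.pt 1) := by
  have hne : past.target ≠ D.pt 1 := by
    rw [← h₀.2.1, ← h₀.2.2]
    exact c₀.tip_ne_tgt
  have hex : ∃ c : SLEConfig, c.Realises (remainingDomain D past) past.target (D.pt 1) := ⟨c₀, h₀⟩
  rw [sleMarkovKernel_of_realises κ hne hex]
  exact sleImageLaw_eq_of_realises h0 htr hfv h₀ hex.choose_spec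

end FirstVisit


end Literature.Probability.RandomPlanarGeometry

end
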